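import Literature.NumberTheory.EllipticCurves.Kato2004.MemberHullZetaInputs
import HarnessLib

/-!
# Kato 2004 (Astérisque 295) at Kato's member — the VALUE-GUARDED re-type of `MemberHullZetaInputs`
# (Thm. 12.5 (3), Thm. 12.6 with Lemma 13.10 (1) and 13.14, §14.14 (14.14.1)–(14.14.2), Prop. 14.16 (2),
# Wuthrich L.14): the package `MemberHullValueInputs`, the fact `exists_memberHullValueInputs` whose
# witness clause DISPLAYS Kato's admissible choice `(c,d,a,A)` with non-zero four-cusp factor, and the
# conversions to and from `MemberHullZetaInputs`

Topic `NumberTheory/EllipticCurves`, sub-directory `Kato2004` (namespace = path).  Seat `bsd-potss-rkm`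
(generation 10, cell `bsd-potss`; crux M = item stmt-BirchSwinnertonDyer-19196 `ReducibleKatoMember` of the
routes K9 / K8-t′).  Second sibling of the held named fact `Kato2004.exists_memberHullInputs` (file
`MemberHullInputs.lean`, item 19659) after the typer's zeta-only re-type `Kato2004.exists_memberHullZetaInputs`
(file `MemberHullZetaInputs.lean`, p519008, wi-78945), whose module docstring left OPEN "the planner's other
option (adding `cuspFactor … ≠ 0` to the `ZetaBody` witness clause)".  This file TAKES that option, now that
the Summits-side kernel theorems exist (seat rkm g10, all `--supports 19196`):

* `index_ne_zero` (Thm. 14.5 (2): `#(A ⧸ Λ·ι(𝐲̄)) ≠ 0`) — `Theorems/KatoDescentPotSupersingularMemberIndexOfValue`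
  (p525403): on the lift `𝐲` of a `ZetaBody` witness with `κ′ ≠ 0`, `(cd, A) = 1`, `dd′ ≡ 1 (A)`,
  `cuspFactor f true 1 c d a A d′ ≠ 0` and `L(W,1) ≠ 0` (`f` the newform of `W`), the bottom class
  `proj₀ 𝐲 = z_{0,∅}` is NOT torsion (value law at the bottom level, Kato Thm. 9.7 ∘ 6.6 (1):
  `Λ_{0,∅}(z_{0,∅}) = 1 ⊗ κ′·L_{(pA)}(f,1)/Ω⁺_f·R⁻ ≠ 0`), whence the index is finite by (R0) + rank bookkeeping;
* `isTorsion_quotient` (Thm. 12.5 (2): `F ⧸ Λz` torsion) — `Theorems/…MemberHullRankOne` (p526067): hull with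
  finite cokernel + `rank_Λ 𝐇¹_Γ ≤ 1` ((R2) `IwasawaH1Data.rank_le_one_of_rank_integralH1_le_one` + (R0));
* `z_ne_zero` (Thm. 12.5 (1)) and `lam_constantCoeff_ne_zero` (Lemma 13.10 (1), `λ(0) ≠ 0`) —
  `Theorems/…MemberHullNondegenerate` (p526771): from `j 𝐲 = λ • z`, injectivity and finite cokernel of `j`,
  and the non-torsion of `proj₀ 𝐲`.

So `MemberHullValueInputs W p κ γ I 𝐲` := `MemberHullZetaInputs` MINUS these four clauses (same names, types
and pins for everything kept: the hull `j : 𝐇¹_Γ ↪ F`, `z`, `λ` with `j 𝐲 = λ • z`, the abstract `𝐇²`, the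
pinned `A = H¹(ℤ[1/p],T)`, the maps of (14.14.1) with the pin of `ι`, Thm. 12.5 (3) off `(p)`, `μ = 0`, and
the COUNT Prop. 14.16 (2)), and `exists_memberHullValueInputs` := the outer text of `exists_memberHullZetaInputs`
VERBATIM with the witness clause EXTENDED by the elementary guard
`Int.gcd (c·d) A = 1 ∧ ∃ d′, d·d′ ≡ 1 [ZMOD A] ∧ cuspFactor f true (fun _ ↦ 1) c d a A d′ ≠ 0`
— Kato's admissible `(c,d,a,A)` "with `γ_*^+ ≠ 0`" (Lemma 13.10 (1); the docstring of `MemberHullInputs`: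
`c = 1 + 6pA`, `d = 1 + 6pAN`, `d′ = 1`, so all four cusp symbols coincide and
`R⁻ = cd(c−1)(d−1)·[a/A]⁻ ≠ 0` for a cusp `a/A` with `[a/A]⁻ ≠ 0`, which exists — a THEOREM of the tree:
`Kato2004.valueGuard_satisfiable` (file `Kato2004/ValueGuardSatisfiableProofs.lean`, p531600, with
`Kato2004.exists_ratMinusSymbol_ne_zero`; Manin–Drinfeld, `Ω⁻_f ≠ 0`) gives, for every rational newform `f`,
prime `p` and level `N ≠ 0`, an admissible `(c,d,a,A,d′)` satisfying ALL the displayed guards), displayed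
FORMALLY instead of in prose.  So the guard costs nothing in strength: the fact remains weaker than print.

RELATION TO THE SIBLINGS.  The two facts are not formally comparable clause by clause (v2 has fewer
structure fields but a longer witness clause); both are WEAKER THAN PRINT (Kato's Thm. 12.5/12.6/13.10/14.16
hold for EVERY admissible `(c,d,a,A)`, in particular for one with `R⁻ ≠ 0`).  The kernel theorem
`exists_memberHullValueInputs → rank_eq_analyticRank_of_analyticRank_le_one → exists_memberHullZetaInputs`
(hence `→ exists_memberHullInputs`, hence crux M) is the Summits-side ROUTE-FREE file
`Theorems/KatoDescentPotSupersingularReducibleKatoMemberOfValueInputsNodes.lean` (it needs the value law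
`KatoValue.zetaBody_value_level_one` and (R0), which live under `Summits/`); here only the conversions that
need no arithmetic are given: `MemberHullZetaInputs.toMemberHullValueInputs` (forgetful) and
`MemberHullValueInputs.toMemberHullZetaInputs` (the four clauses supplied as hypotheses), with
`MemberHullValueInputs.ι_injective` / `toIwasawaH2Data` (as for the sibling).

HONEST SCOPE.  Nothing is booked by the re-type: `exists_memberHullValueInputs` is still the transcription of
Kato Thm. 12.5 (3) / 12.6 / 13.10 (1) / 13.14 / 14.16 (2) + Wuthrich L.14 at the member (Kato's Euler system,
explicit reciprocity, Poitou–Tate — no `_holds` expected, size XL); it moves four more PROVED clauses out of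
hypothesis position at the price of one elementary, checkable guard on the witnesses.  BSD is not advanced;
see `MemberHullInputs.lean` ("WHAT THE ABSTRACT FIELDS DO AND DO NOT PIN").  Referee flag
`Kato-12.6-13.10-14.16(2)-member-reading-reducible` as for the siblings.

## References

* K. Kato, *p-adic Hodge theory and values of zeta functions of modular forms*, Astérisque 295 (2004):
  §8.3 (p. 181), (12.2.1) (p. 220), Thm. 12.4 (p. 221), Thm. 12.5 (pp. 221–222), Thm. 12.6, Rem. 12.7
  (p. 222), 13.9, Lemma 13.10 (1) (pp. 229–230), 13.14 (p. 234), Thm. 14.5 (p. 236), §14.8 (p. 238), §14.14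
  (14.14.1)–(14.14.2) (p. 243), Prop. 14.16 (2) (p. 244), Thm. 6.6 (1) (p. 163), Thm. 9.7 (p. 189) — store key
  `paper:doi-10-24033-ast-639`, read through `MemberHullInputs.lean` (verbatim quotations). [Kato2004Asterisque]
* C. Wuthrich, Doc. Math. 19 (2014), Lemma 12 (p. 395), Lemma 14 (p. 396). [Wuthrich2014]
* R. Greenberg, LNM 1716 (1999), Prop. 4.13 and §3. [GreenbergLNM1716]
* C.-H. Kim, Amer. J. Math. 148 (2026), §3.2.3. [Kim2022StructureSelmer]
* Tree: `MemberHullZetaInputs.lean`, `MemberHullInputs.lean` (the siblings), `EulerSystemValues.lean`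
  (`ZetaBody`, `cuspFactor`); Summits side (not imported): `Theorems/KatoDescentPotSupersingularMember{IndexOfValue,
  HullRankOne,HullNondegenerate}.lean`, `…ReducibleKatoMemberOfValueInputsNodes.lean`.
-/

noncomputable section

open scoped NumberField TensorProduct
open Field IsDedekindDomain CongruenceSubgroup
open Literature.NumberTheory.GaloisRepresentations
open Literature.NumberTheory.EllipticCurves Literature.NumberTheory.EllipticCurves.ModularForms
open Literature.NumberTheory.EllipticCurves.Kato2004
open Literature.NumberTheory.EllipticCurves.Kato2004.EulerSystemValues Rat.HeightOneSpectrum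
open Literature.NumberTheory.EllipticCurves.IwasawaAlgebra

namespace Literature.NumberTheory.EllipticCurves.Kato2004

section Package

variable (W : WeierstrassCurve ℚ) [W.IsElliptic] (p : ℕ) [Fact p.Prime]
  [ContinuousSMul ℤ_[p] (W.tateModule p)] (κ : ZpExtension ℚ p) (γ : absoluteGaloisGroup ℚ)
  (I : IwasawaH1Data W p κ γ) (y : I.H)

/-- **Kato's rank-`0` descent inputs at his own lattice, VALUE-GUARDED re-type of `MemberHullZetaInputs` —
hypothesis structure (a package of the printed statements; nothing asserted).**  For an elliptic curve `W/ℚ`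
(intended: Kato's member `W_K`, `T_pW ≅ V_{ℤ_p}(f)(1)`), a pinned Iwasawa cohomology `I : IwasawaH1Data W p κ γ`
and an element `y : I.H` (the `Λ`-adic class of a `ZetaBody` family): the reflexive hull `j : I.H ↪ F`
(13.14 / Wuthrich L.12) with Kato's normalised zeta element `z = z_γ⁰ ∈ F` and the multiplier `lam ∈ Λ` of
Lemma 13.10 (1), `j y = lam • z`; the abstract `H2 = 𝐇²(T)⁰`, finitely generated torsion ((12.2.1),
Thm. 12.4 (1)); the module `A = H¹(ℤ[1/p],T)` PINNED to `integralH1 (tateRep W p) p (κ.layerSubgroup 0)`; the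
maps `ι`, `π` of (14.14.1) with `π` surjective, exactness in the middle and the PIN `toH1 ∘ ι ∘ mk = proj₀`;
Thm. 12.5 (3) + Rem. 12.7 off `(p)`; `μ(𝐇²(T)⁰) = 0` (Wuthrich L.14, reducible `W[p]`); and the COUNT
Prop. 14.16 (2) + §14.8 / Greenberg 4.13 + Kim §3.2.3 + Thm. 12.5 (1) for the element `y`.  EXACTLY the field
list of `MemberHullZetaInputs` with the four tree-proved clauses `z_ne_zero` (Thm. 12.5 (1)),
`isTorsion_quotient` (Thm. 12.5 (2)), `lam_constantCoeff_ne_zero` (Lemma 13.10 (1)), `index_ne_zero`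
(Thm. 14.5 (2)) removed (module docstring: they follow from the kept fields, (R0) and the VALUE of the
`ZetaBody` witness under the guard of `exists_memberHullValueInputs`); same names, types, pins.
[cite: Kato2004Asterisque, Thm. 12.4 (1) (p. 221), Thm. 12.5 (3) (p. 222), Thm. 12.6 and Rem. 12.7 (p. 222), Lemma 13.10 (1) (p. 230), 13.14 (p. 234), §14.14 (14.14.1)–(14.14.2) (p. 243), Prop. 14.16 (2) (p. 244), §14.8 (p. 238)]
[cite: Wuthrich2014, Lemma 12 (p. 395), Lemma 14 (p. 396)] [cite: GreenbergLNM1716, Prop. 4.13 and §3 after Lemma 3.3]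
[cite: Kim2022StructureSelmer, §3.2.3 display before Thm. 3.7 (PDF p. 16)] -/
structure MemberHullValueInputs : Type 1 where
  /-- The reflexive hull `F = (𝐇¹_Γ)^{**}` (13.14 / Wuthrich L.12), abstract. -/
  F : Type
  [addCommGroupF : AddCommGroup F]
  [moduleF : _root_.Module (IwasawaAlgebra p) F]
  /-- `F` is finitely generated. -/
  finite_F : Module.Finite (IwasawaAlgebra p) F
  /-- `F` is torsion free. -/
  torsionFree_F : NoZeroSMulDivisors (IwasawaAlgebra p) F
  /-- The inclusion `𝐇¹_Γ ↪ (𝐇¹_Γ)^{**}`. -/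
  j : I.H →ₗ[IwasawaAlgebra p] F
  /-- `j` is injective. -/
  j_injective : Function.Injective j
  /-- The hull has finite (pseudo-null) cokernel. -/
  finite_coker : Finite (F ⧸ LinearMap.range j)
  /-- Kato's normalised zeta element `z_γ⁰` (`γ^+` a `ℤ_p`-basis of `T(−1)^+`), in the hull
  (Thm. 12.6 + 13.14). -/
  z : F
  /-- Lemma 13.10 (1): the multiplier `λ ∈ Λ` of the `(c,d,a(A))`-class. -/
  lam : IwasawaAlgebra p
  /-- Lemma 13.10 (1): `j y = λ • z_γ⁰`. -/
  j_y : j y = lam • z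
  /-- `H2 = 𝐇²(T)⁰`, abstract. -/
  H2 : Type
  [addCommGroupH2 : AddCommGroup H2]
  [moduleH2 : _root_.Module (IwasawaAlgebra p) H2]
  /-- (12.2.1): `𝐇²` is finitely generated. -/
  finite_H2 : Module.Finite (IwasawaAlgebra p) H2
  /-- Thm. 12.4 (1): `𝐇²` is torsion. -/
  isTorsion_H2 : Module.IsTorsion (IwasawaAlgebra p) H2
  /-- `A = H¹(ℤ[1/p], T)` as a `Λ`-module (through the augmentation), pinned by `toH1`. -/
  A : Type
  [addCommGroupA : AddCommGroup A]
  [moduleA : _root_.Module (IwasawaAlgebra p) A]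
  /-- The PIN of `A`: an additive map to `H¹(ℚ, T_pW)` at the bottom layer `κ.layerSubgroup 0 = Γ_ℚ` … -/
  toH1 : A →+ H1 (tateRep W p) (κ.layerSubgroup 0)
  /-- … injective … -/
  toH1_injective : Function.Injective toH1
  /-- … with image exactly the integral classes `H¹(ℤ[1/p], T_pW)` (§8.2, Lemma 8.5) … -/
  mem_range_toH1_iff : ∀ x : H1 (tateRep W p) (κ.layerSubgroup 0),
    x ∈ Set.range toH1 ↔ x ∈ integralH1 (tateRep W p) p (κ.layerSubgroup 0)
  /-- … and `Λ` acting on `A` through the augmentation `g ↦ g(0)` (so `X` acts as `0`). -/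
  toH1_smul : ∀ (g : IwasawaAlgebra p) (a : A), toH1 (g • a) = PowerSeries.constantCoeff g • toH1 a
  /-- (14.14.1), first map `𝐇¹_Γ/X𝐇¹_Γ → H¹(ℤ[1/p],T)`. -/
  ι : coinvariants p I.H →ₗ[IwasawaAlgebra p] A
  /-- (14.14.1), second map `H¹(ℤ[1/p],T) → 𝐇²[X]`. -/
  π : A →ₗ[IwasawaAlgebra p] invariants p H2
  /-- (14.14.1): `π` surjective. -/
  π_surjective : Function.Surjective π
  /-- (14.14.1): exact in the middle. -/
  exact_ι_π : Function.Exact ι π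
  /-- The PIN of `ι`: `ι(x mod X) = proj₀ x` in `H¹(ℚ, T_pW)` (§13.8 / (14.14.1); `IwasawaH1Data.projZero`). -/
  toH1_ι : ∀ x : I.H, toH1 (ι (Submodule.Quotient.mk x)) = I.proj 0 x
  /-- Thm. 12.5 (3) with Rem. 12.7 (potentially good `p`: `𝐇²_loc = 0`), on the `Δ`-trivial component:
  `ℓ_𝔮(𝐇²) ≤ ℓ_𝔮(F/Λz_γ)` at every height-one `𝔮 ≠ (p)`. -/
  divisibility_offP : ∀ 𝔮 : PrimeSpectrum (IwasawaAlgebra p), 𝔮.asIdeal.height = 1 →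
    𝔮.asIdeal ≠ augIdealP p →
      Module.lengthAt (IwasawaAlgebra p) H2 𝔮 ≤
        Module.lengthAt (IwasawaAlgebra p) (F ⧸ (IwasawaAlgebra p) ∙ z) 𝔮
  /-- Wuthrich 2014 Lemma 14 + global duality (reducible `W[p]`, `p` odd): `μ(𝐇²(T)⁰) = 0`. -/
  mu_H2 : muInvariant p H2 = 0
  /-- THE COUNT (Prop. 14.16 (2) for the element `y₀ = proj₀ y` + §14.8 / Greenberg Prop. 4.13 & §3 +
  Kim §3.2.3 + Thm. 12.5 (1) with Lemma 13.10 (1); module docstring of `MemberHullInputs.lean`):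
  `ord_p #Ш(W)[p^∞] + v_p(Tam W) + ord_p [A : Λ·ι(ȳ)] ≤ ord_p(L(W,1)/Ω(W)) + v_p(λ(0)) + ord_p #(𝐇²/X𝐇²)
  + 3·ord_p #W(ℚ)_tors`. -/
  count : ∃ q : ℚ, W.entireLFunction 1 / (W.realPeriodRat : ℂ) = (q : ℂ) ∧
    (padicValNat p (Nat.card (AddCommGroup.primaryComponent W.sha p)) : ℤ) +
        padicValNat p W.tamagawaProduct +
        padicValNat p (Nat.card (A ⧸ (IwasawaAlgebra p) ∙ ι (Submodule.Quotient.mk y))) ≤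
      padicValRat p q + ((PowerSeries.constantCoeff lam).valuation : ℤ) +
        padicValNat p (Nat.card (coinvariants p H2)) + 3 * (padicValNat p W.torsionOrder : ℤ)

attribute [instance] MemberHullValueInputs.addCommGroupF MemberHullValueInputs.moduleF
  MemberHullValueInputs.addCommGroupH2 MemberHullValueInputs.moduleH2
  MemberHullValueInputs.addCommGroupA MemberHullValueInputs.moduleA

end Package

/-! ## Conversions between the two packages (no arithmetic here) -/

section Conversions

variable {W : WeierstrassCurve ℚ} [W.IsElliptic] {p : ℕ} [Fact p.Prime]
  [ContinuousSMul ℤ_[p] (W.tateModule p)] {κ : ZpExtension ℚ p} {γ : absoluteGaloisGroup ℚ}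
  {I : IwasawaH1Data W p κ γ} {y : I.H}

/-- **Every `MemberHullZetaInputs` package forgets to a `MemberHullValueInputs` package** (drop the four
clauses). [cite: Kato2004Asterisque, Thm. 12.5 (1)–(3) (pp. 221–222), §14.14 (14.14.1) (p. 243)] -/
def MemberHullZetaInputs.toMemberHullValueInputs (Z : MemberHullZetaInputs W p κ γ I y) :
    MemberHullValueInputs W p κ γ I y where
  F := Z.F
  finite_F := Z.finite_F
  torsionFree_F := Z.torsionFree_F
  j := Z.j
  j_injective := Z.j_injective
  finite_coker := Z.finite_coker
  z := Z.z
  lam := Z.lam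
  j_y := Z.j_y
  H2 := Z.H2
  finite_H2 := Z.finite_H2
  isTorsion_H2 := Z.isTorsion_H2
  A := Z.A
  toH1 := Z.toH1
  toH1_injective := Z.toH1_injective
  mem_range_toH1_iff := Z.mem_range_toH1_iff
  toH1_smul := Z.toH1_smul
  ι := Z.ι
  π := Z.π
  π_surjective := Z.π_surjective
  exact_ι_π := Z.exact_ι_π
  toH1_ι := Z.toH1_ι
  divisibility_offP := Z.divisibility_offP
  mu_H2 := Z.mu_H2
  count := Z.count

namespace MemberHullValueInputs

/-- **From a value package back to a `MemberHullZetaInputs` package, the four dropped clauses SUPPLIED as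
hypotheses** (on the rows of `exists_memberHullValueInputs` they are discharged by the Summits-side theorems
`MemberHullNondegenerate.ne_zero_of_hull_smul` / `constantCoeff_ne_zero_of_hull_smul`,
`MemberHullRankOne.isTorsion_hull_quotient`, `MemberIndexOfValue.IwasawaH2Data.natCard_quotient_span_ne_zero_of_zetaBody`;
module docstring). [cite: Kato2004Asterisque, Thm. 12.5 (1)(2) (pp. 221–222), Lemma 13.10 (1) (p. 230), Thm. 14.5 (2) (p. 236)] -/
def toMemberHullZetaInputs (V : MemberHullValueInputs W p κ γ I y) (hz : V.z ≠ 0)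
    (hT : Module.IsTorsion (IwasawaAlgebra p) (V.F ⧸ (IwasawaAlgebra p) ∙ V.z))
    (hlam : PowerSeries.constantCoeff V.lam ≠ 0)
    (hidx : Nat.card (V.A ⧸ (IwasawaAlgebra p) ∙ V.ι (Submodule.Quotient.mk y)) ≠ 0) :
    MemberHullZetaInputs W p κ γ I y where
  F := V.F
  finite_F := V.finite_F
  torsionFree_F := V.torsionFree_F
  j := V.j
  j_injective := V.j_injective
  finite_coker := V.finite_coker
  z := V.z
  z_ne_zero := hz
  isTorsion_quotient := hT
  lam := V.lam
  j_y := V.j_y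
  lam_constantCoeff_ne_zero := hlam
  H2 := V.H2
  finite_H2 := V.finite_H2
  isTorsion_H2 := V.isTorsion_H2
  A := V.A
  toH1 := V.toH1
  toH1_injective := V.toH1_injective
  mem_range_toH1_iff := V.mem_range_toH1_iff
  toH1_smul := V.toH1_smul
  ι := V.ι
  π := V.π
  π_surjective := V.π_surjective
  exact_ι_π := V.exact_ι_π
  toH1_ι := V.toH1_ι
  divisibility_offP := V.divisibility_offP
  mu_H2 := V.mu_H2
  index_ne_zero := hidx
  count := V.count

/-- **The dropped-clause-free part of (14.14.1) is still there: `ι` is injective on every value package**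
(`κ` cyclotomic, `γ` a topological generator) — pin `toH1 (ι (mk x)) = proj₀ x`, injectivity of `toH1`, and
`TwistTate.mem_TSubmodule_of_proj_zero_eq_zero` (rkm g8), as for the sibling.
[cite: Kato2004Asterisque, §14.14 (14.14.1) (p. 243) and §13.8 (p. 228)] -/
theorem ι_injective (V : MemberHullValueInputs W p κ γ I y) (hκ : κ.IsCyclotomic)
    (hγ : κ.IsTopGenerator γ) : Function.Injective V.ι := by
  rw [injective_iff_map_eq_zero]
  intro x hx
  induction x using Submodule.Quotient.induction_on with
  | H x =>
    have h0 : I.proj 0 x = 0 := by rw [← V.toH1_ι x, hx, map_zero]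
    exact (Submodule.Quotient.mk_eq_zero _).mpr
      (TwistTate.mem_TSubmodule_of_proj_zero_eq_zero W p κ hκ hγ I x h0)

/-- The `(H2, A, toH1, ι, π)`-fields of a value package form a descent package `IwasawaH2Data W p κ γ I`.
[cite: Kato2004Asterisque, §14.14 (14.14.1) (p. 243), (12.2.1) (p. 220), Thm. 12.4 (1) (p. 221)] -/
def toIwasawaH2Data (V : MemberHullValueInputs W p κ γ I y) (hκ : κ.IsCyclotomic)
    (hγ : κ.IsTopGenerator γ) : IwasawaH2Data W p κ γ I where
  H2 := V.H2
  finite_H2 := V.finite_H2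
  isTorsion_H2 := V.isTorsion_H2
  A := V.A
  toH1 := V.toH1
  toH1_injective := V.toH1_injective
  mem_range_toH1_iff := V.mem_range_toH1_iff
  toH1_smul := V.toH1_smul
  ι := V.ι
  π := V.π
  ι_injective := V.ι_injective hκ hγ
  π_surjective := V.π_surjective
  exact_ι_π := V.exact_ι_π
  toH1_ι := V.toH1_ι

end MemberHullValueInputs

end Conversions

/-! ## The named fact: the value-guarded package exists at Kato's member -/

/-- **Kato 2004, Thm. 12.5 (3), 12.6 + Lemma 13.10 (1) + 13.14, §14.14 (14.14.1)–(14.14.2), Prop. 14.16 (2) +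
§14.8 (with Greenberg Prop. 4.13 / §3, Kim §3.2.3), (12.2.1) and Thm. 12.4 (1) for `𝐇²`, and Wuthrich 2014
Lemma 14, AT KATO'S LATTICE `T = V_{ℤ_p}(f)(1)`, for an admissible datum `(c,d,a,A)` WITH NON-ZERO FOUR-CUSP
FACTOR: the VALUE-GUARDED rank-`0` descent inputs EXIST at Kato's member.**  For every globally minimal
elliptic curve `W/ℚ` and every prime `p ≠ 2` of ADDITIVE, POTENTIALLY GOOD (`0 ≤ ord_p j(W)`) reduction with
`W[p]` REDUCIBLE, `L(W,1) ≠ 0` and `Ш(W/ℚ)` finite, there is a GLOBALLY MINIMAL curve `W_K/ℚ`, `ℚ`-isogenous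
to `W` (Kato's member), such that for the newform `f` of `W` and every family of complex embeddings `ι` there
are witnesses `(κ', Λ', c, d, a, A, z, x)` with `κ' ≠ 0`, `A ≥ 1`, `(c, 6pA) = 1`, `(d, 6pN) = 1`, AND
`(cd, A) = 1` and `d·d′ ≡ 1 (A)`, `R⁻(c,d,a,A;d′) = cuspFactor f true 1 c d a A d′ ≠ 0` for some `d′`
(Kato's choice of Lemma 13.10 (1) / Thm. 12.6 with `γ_*^+ ≠ 0`, displayed), satisfying
`ZetaBody W_K p f ι κ' Λ' c d a A z x`, AND for every cyclotomic `ℤ_p`-tower `κ` with topological generator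
`γ`, every `I : IwasawaH1Data W_K p κ γ` and THE element `𝐲 ∈ I.H` lifting the corestricted `p`-power levels,
the structure `MemberHullValueInputs W_K p κ γ I 𝐲` is inhabited.  VERBATIM the outer text of
`exists_memberHullZetaInputs` with the guard added and `MemberHullValueInputs` for `MemberHullZetaInputs`;
the four dropped clauses are restored by the Summits-side kernel theorem (module docstring).  A CONSTRUCTION
fact (D-0014): weaker than print, never stronger; nothing asserted; no `_holds` expected (size XL).  Referee
flag `Kato-12.6-13.10-14.16(2)-member-reading-reducible` as for the siblings.
[cite: Kato2004Asterisque, §8.3 (p. 181), (12.2.1) (p. 220), Thm. 12.4 (1) (p. 221), Thm. 12.5 (3) (p. 222), Thm. 12.6 and Rem. 12.7 (p. 222), 13.9 and Lemma 13.10 (1) (pp. 229–230), 13.14 (p. 234), §14.8 (p. 238), §14.14 (14.14.1)–(14.14.2) (p. 243), Prop. 14.16 (2) (p. 244), (8.1.3) (p. 180), Ex. 13.3 (p. 225), Prop. 8.12 (p. 186), Thm. 9.7 (p. 189), Thm. 6.6 (1) (p. 163)]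
[cite: Wuthrich2014, §3.2 and Lemma 12 (pp. 394–395), Lemma 14 (p. 396)]
[cite: GreenbergLNM1716, Prop. 4.13 and the paragraph following its proof; §3 after Lemma 3.3]
[cite: Kim2022StructureSelmer, §3.2.3 display before Thm. 3.7 (PDF p. 16)]
[cite: SilvermanAEC2009, Prop. III.4.12 with Rem. III.4.13.2] -/
def exists_memberHullValueInputs : Prop :=
  ∀ (W : WeierstrassCurve ℚ) [W.IsElliptic] [W.IsGloballyMinimal] (p : ℕ) [Fact p.Prime]
    (hp : p ≠ 2),
    ¬ W.HasGoodReductionAtPrime p → ¬ W.HasMultiplicativeReductionAtPrime p →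
    0 ≤ padicValRat p W.j →
    ¬ W.HasIrreducibleModPGaloisRep p →
    W.entireLFunction 1 ≠ 0 → Finite W.sha →
    ∃ (W' : WeierstrassCurve ℚ) (_ : W'.IsElliptic) (_ : W'.IsGloballyMinimal),
      WeierstrassCurve.IsIsogenous W W' ∧
      ∀ [ContinuousSMul ℤ_[p] (W'.tateModule p)] [Module.Free ℤ_[p] (W'.tateModule p)]
        [Module.Finite ℤ_[p] (W'.tateModule p)],
      ∀ {N : ℕ} [NeZero N] (f : CuspForm (Gamma0 N) 2), IsNewformOf W f →
      ∀ (ι : (m : ℕ) → (CyclotomicField m ℚ →+* ℂ)),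
      ∃ (κ' : ℝ) (Λ' : ∀ (k : ℕ) (r : Finset (HeightOneSpectrum (𝓞 ℚ))),
          H1 (tateRep W' p) (cycSubgroup p k r) →ₗ[ℤ_[p]] ℚ_[p] ⊗[ℚ] CyclotomicField (cycLevel p k r) ℚ)
        (c d a : ℤ) (A : ℕ)
        (z : ∀ (k : ℕ) (r : (cyclotomicLevelsRat p (badPlaces c d A N)).Ideals),
          H1 (tateRep W' p) ((cyclotomicLevelsRat p (badPlaces c d A N)).level k r.1))
        (x : ∀ (k : ℕ) (r : (cyclotomicLevelsRat p (badPlaces c d A N)).Ideals),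
          CyclotomicField (cycLevel p k r.1) ℚ),
        κ' ≠ 0 ∧ 0 < A ∧ Int.gcd c (6 * p * A) = 1 ∧ Int.gcd d (6 * p * N) = 1 ∧
        Int.gcd (c * d) A = 1 ∧
        (∃ d' : ℤ, d * d' ≡ 1 [ZMOD (A : ℤ)] ∧ cuspFactor f true (fun _ ↦ 1) c d a A d' ≠ 0) ∧
        ZetaBody W' p f ι κ' Λ' c d a A z x ∧
        ∀ (κ : ZpExtension ℚ p) (γ : absoluteGaloisGroup ℚ) (hκ : κ.IsCyclotomic),
          κ.IsTopGenerator γ →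
          ∀ (I : IwasawaH1Data W' p κ γ) (y : I.H),
            (∀ n : ℕ, I.proj n y = levelToLayer W' p hκ hp (badPlaces c d A N) n
              (z (n + 1) (cyclotomicLevelsRat p (badPlaces c d A N)).idealOne)) →
            Nonempty (MemberHullValueInputs W' p κ γ I y)

end Literature.NumberTheory.EllipticCurves.Kato2004

end
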